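import Summits.CriticalPhenomena.PercolationContinuityZ3.Theses.PercNearOneGluing
import Summits.CriticalPhenomena.PercolationContinuityZ3.Theorems.PercNearOneGluingAdditiveGluingSetGlueK0Closed
import Summits.CriticalPhenomena.PercolationContinuityZ3.Theorems.PercNearOneGluingAdditiveGluingK0OfCovTransfer
import Summits.CriticalPhenomena.PercolationContinuityZ3.Theorems.PercNearOneGluingAdditiveGluingK0CovTransferPOfQ
import Summits.CriticalPhenomena.PercolationContinuityZ3.Theorems.PercNearOneGluingAdditiveGluingK0AttachTransfer
import Summits.CriticalPhenomena.PercolationContinuityZ3.Theorems.PercNearOneGluingAdditiveGluingK0AttachTransferD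
import Summits.CriticalPhenomena.PercolationContinuityZ3.Theorems.PercNearOneGluingAdditiveGluingTOfTD
import Summits.CriticalPhenomena.PercolationContinuityZ3.Theorems.PercNearOneGluingAdditiveGluingK0OfPhiTransfer
import Summits.CriticalPhenomena.PercolationContinuityZ3.Theorems.PercNearOneGluingAdditiveGluingAuxBeta
import Summits.CriticalPhenomena.PercolationContinuityZ3.Theorems.PercNearOneGluingAdditiveGluingFibreCriterionPhi
import HarnessLib

/-!
# Line `tieline` — official skeleton v28 (lead c16, 2026-08-20; = v27 of lead c15 verbatim — stubs (T), (Φ_D), (CNT_Φ), (K₀-set)₃; three closings)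

Crux (FIXED, by name): `Summit.CriticalPhenomena.PercolationContinuityZ3.Theses.PercNearOneGluing.AdditiveGluing`
(`P(o ↔ A) − t ≤ P(o ↔ b)` whenever `t ≥ 0` and `P(a ↔ b) ≥ 1 − t` on `A`).

## Composition (every step an ACCEPTED Theorems file)
* `additiveGluing_of_k0_k0set3` (…SetGlueK0Closed.lean): (K₀) [pair kernel, `|S| = 2`] + (K₀-set) [`|S| ≥ 3`] ⟹ crux
  (set-gluing reduction `additiveGluing_of_half_k0set2` + `setGlue_half`, Kozma–Nitzan §5.3 min-tie + Lemma 4 at the set level).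
* `k0_of_covTransfer` (…K0OfCovTransfer.lean): (K₀) ⟸ (γ) attachment transfer [LANDED `stub_k0AttachTransfer_c9`]
  + (α) covariance transfer for `P` + (β) covariance transfer for `Q` + τ-order.
* `k0CovTransferP_of_Q` (…K0CovTransferPOfQ.lean): (α) ⟸ (β) with the relays swapped + (γ″) [LANDED
  `stub_k0AttachTransferD_c10`].
Hence the crux follows from exactly TWO registered stubs:
* `stub_k0CovTransferQ_c9` = (T), the 5-point covariance transfer
  `σ₁(o)·μ(N) ≥ σ₁(c)·μ(N ∩ o↔c)`, `σ₁(x) = μ(D∩u↔b)μ(D∩v↔x) − μ(D)μ(D∩u↔b∩v↔x) ≥ 0` (vdBHK), `D = {u↮v}`, `N = {c↮u}∩{c↮v}`;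
  equivalently (T_D) (`k0CovTransferQ_of_TD`, …TOfTD.lean) and implied by the weight-free fibre count positivity (CNT)
  (`FibreCount.covTransferQ_of_fibres`, …FibreCriterion.lean, registered sub-goal `stub_fibreSumT_nonneg_c12`).
* `stub_k0set3_g2` = (K₀-set) for `|S| ≥ 3` (png-lead line): `μ(c↮S ∩ o↔c)·(G_S − Γ_c) ≤ μ(c↮S)·(G_S − Γ_o)`.
Numerics (predecessors, exact): (T) 0 violations in the exhaustive n = 8 census at p = 1/2 (2^28 graphs) and > 10^8 weighted instances;
(CNT) 0 negative fibre counts on all graphs n ≤ 6 (m ≤ 12 sampled roles) — see Cruxes/AdditiveGluing/LeadMath-c9…c12.md, OPEN-K0.md.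
[cite: KozmaNitzan2024, Conjecture 1 (p. 3), Theorem 1 (pp. 7–8), Lemma 4 (p. 9), §5.3 (p. 34), Question 7 (p. 36)]
[cite: VandenbergHaggstromKahn2005, Thms. 1.3–1.5]

## v26 (lead c14): a second, WEAKER sufficient stub for the pair kernel — the Φ-transfer
`stub_phiTransfer_c14` (Φ_D): `μ(D∩N∩oc)·(μ(D∩ub)·μ(D∩vb∩cuᶜ) − μ(D∩vb)·μ(D∩ub∩vc)) ≤ μ(D∩N)·(μ(D∩ub)·μ(D∩vb∩ouᶜ) − μ(D∩vb)·μ(D∩ub∩vo))`,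
i.e. `Φ(o) ≥ π_D·Φ(c)` for `Φ(x) = P_D(x ∉ C_u | b ∈ C_v) − P_D(x ∈ C_v | b ∈ C_u) ∈ [0,1]` (`Φ(u) = Φ(v) = 0`, `Φ(b) = 1`: a percolation
harmonic measure of `b` against `{u,v}`; the stub is its one-step super-mean-value property), symmetric under `u ↔ v`, first order.
EXACT IDENTITY (LeadMath-c14 §5; Lean: `phiTransfer_of_TD`, in flight): `μ(D)·slack(Φ_D) = m₁·slack(T_D) + m₂·slack(T_D, u↔v) + m₁m₂μ(DN)(μ(D, o free) − μ(DNJ))`,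
so (T_D) at two tuples implies (Φ_D).  `k0_of_phiTransfer` (…K0OfPhiTransfer.lean, LANDED p193333): (Φ_D) + `stub_auxBeta_c14` (LANDED p193328,
…AuxBeta.lean) + τ-order + (γ″) + vdBHK ⟹ (K₀).  Hence the crux ALSO follows from `stub_phiTransfer_c14` + `stub_k0set3_g2` (`additiveGluing_closed_phi`).
Numerics: (Φ_D) 0 violations in > 10^6 exact weighted instances (graphs + 3-uniform hypergraphs, n ≤ 7) and in the kit census n ≤ 11 (j069347); CAUTION: the
all-conditional (T_D) (= `stub_kernelTD_c13`, NOT used by either closing) is FALSE for hypergraph percolation (exact witness n = 9, three 3-edges, kit j067396,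
LeadMath-c14 §6) while (T), (Φ_D) hold there — any proof of (T_D)/(SD)/(ED) must use a property of GRAPHS.
-/

namespace Summit.CriticalPhenomena.PercolationContinuityZ3.Cruxes.AdditiveGluing.TieLine

open MeasureTheory Set Literature.Probability.LatticeModels Literature.Probability.Percolation
open Summit.CriticalPhenomena.PercolationContinuityZ3.Theorems

noncomputable section

/-- **Stub (T) — the 5-point covariance transfer for `Q`** (registered `stub_k0CovTransferQ_c9`, verbatim):
`μ(D)·(Q_o μ(N) − Q_c μ(NJ)) ≤ μ(D∩u↔b)·(a_o μ(N) − a_c μ(NJ))`, `D = {u↮v}`, `Q_x = μ(D∩u↔b∩v↔x)`, `a_x = μ(D∩v↔x)`,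
`N = {c↮u}∩{c↮v}`, `NJ = N ∩ {o↔c}`.  Equivalently `σ₁(o)μ(N) ≥ σ₁(c)μ(NJ)` with `σ₁(x) = −μ(D)²·Cov_D(u↔b, v↔x) ≥ 0`.
[cite: KozmaNitzan2024, Question 7 (p. 36)] [cite: VandenbergHaggstromKahn2005, Thm. 1.5] -/
theorem stub_k0CovTransferQ_c9 : ∀ (n : ℕ) (w : Sym2 (Fin n) → unitInterval) (o b u v c : Fin n), (Literature.Probability.LatticeModels.prodBernoulli w).real ((Literature.Probability.Percolation.openConn u v)ᶜ : Set (Literature.Probability.Percolation.BondConfig (Fin n))) * ((Literature.Probability.LatticeModels.prodBernoulli w).real ((Literature.Probability.Percolation.openConn u v)ᶜ ∩ Literature.Probability.Percolation.openConn u b ∩ Literature.Probability.Percolation.openConn v o : Set (Literature.Probability.Percolation.BondConfig (Fin n))) * (Literature.Probability.LatticeModels.prodBernoulli w).real ((Literature.Probability.Percolation.openConn c u)ᶜ ∩ (Literature.Probability.Percolation.openConn c v)ᶜ : Set (Literature.Probability.Percolation.BondConfig (Fin n))) - (Literature.Probability.LatticeModels.prodBernoulli w).real ((Literature.Probability.Percolation.openConn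 u v)ᶜ ∩ Literature.Probability.Percolation.openConn u b ∩ Literature.Probability.Percolation.openConn v c : Set (Literature.Probability.Percolation.BondConfig (Fin n))) * (Literature.Probability.LatticeModels.prodBernoulli w).real ((Literature.Probability.Percolation.openConn c u)ᶜ ∩ (Literature.Probability.Percolation.openConn c v)ᶜ ∩ Literature.Probability.Percolation.openConn o c : Set (Literature.Probability.Percolation.BondConfig (Fin n)))) ≤ (Literature.Probability.LatticeModels.prodBernoulli w).real ((Literature.Probability.Percolation.openConn u v)ᶜ ∩ Literature.Probability.Percolation.openConn u b : Set (Literature.Probability.Percolation.BondConfig (Fin n))) * ((Literature.Probability.LatticeModels.prodBernoulli w).real ((Literature.Probability.Percolation.openConn u v)ᶜ ∩ Literature.Probability.Percolation.openConn v o : Set (Literature.Probability.Percolation.BondConfig (Fin n))) * (Literature.Probability.LatticeModels.prodBernoulli w).real ((Literature.Probability.Percolation.openConn c u)ᶜ ∩ (Literature.Probability.Percolation.openConn c v)ᶜ : Set (Literature.Probability.Percolation.BondConfig (Fin n))) - (Literature.Probability.LatticeModels.prodBernoulli w).real ((Literature.Probability.Percolation.openConn u v)ᶜ ∩ Literature.Probability.Percolation.openConn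 v c : Set (Literature.Probability.Percolation.BondConfig (Fin n))) * (Literature.Probability.LatticeModels.prodBernoulli w).real ((Literature.Probability.Percolation.openConn c u)ᶜ ∩ (Literature.Probability.Percolation.openConn c v)ᶜ ∩ Literature.Probability.Percolation.openConn o c : Set (Literature.Probability.Percolation.BondConfig (Fin n)))) := by
  sorry

/-- **Stub (K₀-set), `|S| ≥ 3`** (registered `stub_k0set3_g2`, verbatim; png-lead line): for a relay SET `S` with `τ`-minimiser `s₀`,
spectator `c ∉ S`, observer `o`, target `b`:
`μ(c↮S ∩ o↔c)·(G_S − Γ_c) ≤ μ(c↮S)·(G_S − Γ_o)`, `G_S = μ(S↔b) − τ_{s₀}`, `Γ_x = μ(x↮b ∩ x↔S ∩ S↔b)`.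
[cite: KozmaNitzan2024, Lemma 4 (p. 9), §5.3 (p. 34), Question 7 (p. 36)] -/
theorem stub_k0set3_g2 : ∀ (n : ℕ) (w : Sym2 (Fin n) → unitInterval) (S : Finset (Fin n)) (o b c s₀ : Fin n), 3 ≤ S.card → s₀ ∈ S → c ∉ S → (∀ s ∈ S, (prodBernoulli w).real (openConn s₀ b) ≤ (prodBernoulli w).real (openConn s b)) → (prodBernoulli w).real ((⋃ s ∈ S, (openConn c s : Set (BondConfig (Fin n))))ᶜ ∩ openConn o c) * ((prodBernoulli w).real (⋃ s ∈ S, (openConn s b : Set (BondConfig (Fin n)))) - (prodBernoulli w).real (openConn s₀ b) - (prodBernoulli w).real ((openConn c b)ᶜ ∩ (⋃ s ∈ S, (openConn c s : Set (BondConfig (Fin n)))) ∩ (⋃ s ∈ S, (openConn s b : Set (BondConfig (Fin n)))))) ≤ (prodBernoulli w).real ((⋃ s ∈ S, (openConn c s : Set (BondConfig (Fin n))))ᶜ) * ((prodBernoulli w).real (⋃ s ∈ S, (openConn s b : Set (BondConfig (Fin n)))) - (prodBernoulli w).real (openConn s₀ b) - (prodBernoulli w).real ((openConn o b)ᶜ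 ∩ (⋃ s ∈ S, (openConn o s : Set (BondConfig (Fin n)))) ∩ (⋃ s ∈ S, (openConn s b : Set (BondConfig (Fin n)))))) := by
  sorry

/-- **The crux, closed modulo the two stubs**: `AdditiveGluing` from (T) = `stub_k0CovTransferQ_c9` and (K₀-set)₍≥3₎ = `stub_k0set3_g2`. -/
theorem additiveGluing_closed : Summit.CriticalPhenomena.PercolationContinuityZ3.Theses.PercNearOneGluing.AdditiveGluing :=
  additiveGluing_of_k0_k0set3
    (k0_of_covTransfer stub_k0AttachTransfer_c9
      (k0CovTransferP_of_Q stub_k0CovTransferQ_c9 stub_k0AttachTransferD_c10) stub_k0CovTransferQ_c9)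
    stub_k0set3_g2

/-- Alias in the `<CruxDecl>_of` shape expected by the line protocol. -/
theorem AdditiveGluing_of : Summit.CriticalPhenomena.PercolationContinuityZ3.Theses.PercNearOneGluing.AdditiveGluing :=
  additiveGluing_closed

/-- **Stub (Φ_D) — the Φ-transfer** (registered `stub_phiTransfer_c14`, verbatim; lead c14): with `D = {u↮v}`, `N = {c↮u}∩{c↮v}`,
`m₁ = μ(D∩vb)`, `m₂ = μ(D∩ub)`, `P_x = μ(D∩vb∩{x↮u})`, `Q_x = μ(D∩ub∩{v↔x})`:  `μ(D∩N∩oc)·(m₂P_c − m₁Q_c) ≤ μ(D∩N)·(m₂P_o − m₁Q_o)`,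
i.e. `Φ(o) ≥ π_D Φ(c)`, `Φ(x) = P_x/m₁ − Q_x/m₂ = P_D(x∉C_u | b∈C_v) − P_D(x∈C_v | b∈C_u)`.  Weaker than (T_D) at the two tuples `(o,b,u,v,c)`,
`(o,b,v,u,c)`; symmetric under `u ↔ v`. [cite: KozmaNitzan2024, Lemma 4 (p. 9), Question 7 (p. 36)] [cite: VandenbergHaggstromKahn2005, Thm. 1.5] -/
theorem stub_phiTransfer_c14 : ∀ (n : ℕ) (w : Sym2 (Fin n) → unitInterval) (o b u v c : Fin n), (Literature.Probability.LatticeModels.prodBernoulli w).real ((Literature.Probability.Percolation.openConn u v)ᶜ ∩ ((Literature.Probability.Percolation.openConn c u)ᶜ ∩ (Literature.Probability.Percolation.openConn c v)ᶜ) ∩ Literature.Probability.Percolation.openConn o c : Set (Literature.Probability.Percolation.BondConfig (Fin n))) * ((Literature.Probability.LatticeModels.prodBernoulli w).real ((Literature.Probability.Percolation.openConn u v)ᶜ ∩ Literature.Probability.Percolation.openConn u b : Set (Literature.Probability.Percolation.BondConfig (Fin n))) * (Literature.Probability.LatticeModels.prodBernoulli w).real ((Literature.Probability.Percolation.openConn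 u v)ᶜ ∩ Literature.Probability.Percolation.openConn v b ∩ (Literature.Probability.Percolation.openConn c u)ᶜ : Set (Literature.Probability.Percolation.BondConfig (Fin n))) - (Literature.Probability.LatticeModels.prodBernoulli w).real ((Literature.Probability.Percolation.openConn u v)ᶜ ∩ Literature.Probability.Percolation.openConn v b : Set (Literature.Probability.Percolation.BondConfig (Fin n))) * (Literature.Probability.LatticeModels.prodBernoulli w).real ((Literature.Probability.Percolation.openConn u v)ᶜ ∩ Literature.Probability.Percolation.openConn u b ∩ Literature.Probability.Percolation.openConn v c : Set (Literature.Probability.Percolation.BondConfig (Fin n)))) ≤ (Literature.Probability.LatticeModels.prodBernoulli w).real ((Literature.Probability.Percolation.openConn u v)ᶜ ∩ ((Literature.Probability.Percolation.openConn c u)ᶜ ∩ (Literature.Probability.Percolation.openConn c v)ᶜ) : Set (Literature.Probability.Percolation.BondConfig (Fin n))) * ((Literature.Probability.LatticeModels.prodBernoulli w).real ((Literature.Probability.Percolation.openConn u v)ᶜ ∩ Literature.Probability.Percolation.openConn u b : Set (Literature.Probability.Percolation.BondConfig (Fin n))) * (Literature.Probability.LatticeModels.prodBernoulli w).real ((Literature.Probability.Percolation.openConn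 u v)ᶜ ∩ Literature.Probability.Percolation.openConn v b ∩ (Literature.Probability.Percolation.openConn o u)ᶜ : Set (Literature.Probability.Percolation.BondConfig (Fin n))) - (Literature.Probability.LatticeModels.prodBernoulli w).real ((Literature.Probability.Percolation.openConn u v)ᶜ ∩ Literature.Probability.Percolation.openConn v b : Set (Literature.Probability.Percolation.BondConfig (Fin n))) * (Literature.Probability.LatticeModels.prodBernoulli w).real ((Literature.Probability.Percolation.openConn u v)ᶜ ∩ Literature.Probability.Percolation.openConn u b ∩ Literature.Probability.Percolation.openConn v o : Set (Literature.Probability.Percolation.BondConfig (Fin n)))) := by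
  sorry

/-- **The crux, closed modulo the Φ-route stubs**: `AdditiveGluing` from (Φ_D) = `stub_phiTransfer_c14` (+ the LANDED `stub_auxBeta_c14`,
`k0_of_phiTransfer`) and (K₀-set)₍≥3₎ = `stub_k0set3_g2`.  Alternative to `additiveGluing_closed` (which uses (T)). -/
theorem additiveGluing_closed_phi : Summit.CriticalPhenomena.PercolationContinuityZ3.Theses.PercNearOneGluing.AdditiveGluing :=
  additiveGluing_of_k0_k0set3 (k0_of_phiTransfer stub_phiTransfer_c14 stub_auxBeta_c14) stub_k0set3_g2

/-- **Stub (CNT_Φ) — fibre positivity of the Φ-transfer** (registered `stub_fibreSumPhi_nonneg_c15`; lead c15): for every graph size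
`n`, roles `(o, b, u, v, c)` and count vector `I : Sym2 (Fin n) → ℕ`, the signed number of replica TRIPLES with per-edge open-count `I`
realising the four cubic terms of (Φ_D) (`+ DN·(D∩ub)·(D∩vb∩ouᶜ)`, `− DN·(D∩vb)·(D∩ub∩vo)`, `− DNJ·(D∩ub)·(D∩vb∩cuᶜ)`,
`+ DNJ·(D∩vb)·(D∩ub∩vc)`; c12's `FibreCount.fibreSum4`) is nonnegative.  A WEIGHT-FREE counting statement (tensor-Bernstein coefficient
of the Φ cubic); verified by exact enumeration on random graphs n ≤ 7, m ≤ 9 (2.2·10⁶ fibres, 0 negative; LeadMath-c15 §5) and by lead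
c14 (5·10⁷ counts); equivalent to the existence, fibre by fibre, of an injection of negative triples into positive ones permuting
replica labels edgewise (the van den Berg–Kesten–Reimer paradigm).  Implies `stub_phiTransfer_c14` for every weight vector
(`FibreCount.phiTransfer_of_fibres`, LANDED p199131). [folklore] [cite: KozmaNitzan2024, Question 7 (p. 36)] -/
theorem stub_fibreSumPhi_nonneg_c15 : ∀ (n : ℕ) (o b u v c : Fin n) (I : Sym2 (Fin n) → ℕ), 0 ≤ FibreCount.fibreSum4 1 (-1) (-1) 1
    ((Literature.Probability.Percolation.openConn u v)ᶜ ∩ ((Literature.Probability.Percolation.openConn c u)ᶜ ∩ (Literature.Probability.Percolation.openConn c v)ᶜ)) ((Literature.Probability.Percolation.openConn u v)ᶜ ∩ Literature.Probability.Percolation.openConn u b)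
      ((Literature.Probability.Percolation.openConn u v)ᶜ ∩ Literature.Probability.Percolation.openConn v b ∩ (Literature.Probability.Percolation.openConn o u)ᶜ)
    ((Literature.Probability.Percolation.openConn u v)ᶜ ∩ ((Literature.Probability.Percolation.openConn c u)ᶜ ∩ (Literature.Probability.Percolation.openConn c v)ᶜ)) ((Literature.Probability.Percolation.openConn u v)ᶜ ∩ Literature.Probability.Percolation.openConn v b)
      ((Literature.Probability.Percolation.openConn u v)ᶜ ∩ Literature.Probability.Percolation.openConn u b ∩ Literature.Probability.Percolation.openConn v o)
    ((Literature.Probability.Percolation.openConn u v)ᶜ ∩ ((Literature.Probability.Percolation.openConn c u)ᶜ ∩ (Literature.Probability.Percolation.openConn c v)ᶜ) ∩ Literature.Probability.Percolation.openConn o c) ((Literature.Probability.Percolation.openConn u v)ᶜ ∩ Literature.Probability.Percolation.openConn u b)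
      ((Literature.Probability.Percolation.openConn u v)ᶜ ∩ Literature.Probability.Percolation.openConn v b ∩ (Literature.Probability.Percolation.openConn c u)ᶜ)
    ((Literature.Probability.Percolation.openConn u v)ᶜ ∩ ((Literature.Probability.Percolation.openConn c u)ᶜ ∩ (Literature.Probability.Percolation.openConn c v)ᶜ) ∩ Literature.Probability.Percolation.openConn o c) ((Literature.Probability.Percolation.openConn u v)ᶜ ∩ Literature.Probability.Percolation.openConn v b)
      ((Literature.Probability.Percolation.openConn u v)ᶜ ∩ Literature.Probability.Percolation.openConn u b ∩ Literature.Probability.Percolation.openConn v c) I := by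
  sorry

/-- **The crux, closed modulo the COMBINATORIAL Φ-route stubs**: `AdditiveGluing` from (CNT_Φ) = `stub_fibreSumPhi_nonneg_c15` (via the
LANDED `FibreCount.phiTransfer_of_fibres`, `k0_of_phiTransfer`, `stub_auxBeta_c14`) and (K₀-set)₍≥3₎ = `stub_k0set3_g2`. -/
theorem additiveGluing_closed_fibrePhi : Summit.CriticalPhenomena.PercolationContinuityZ3.Theses.PercNearOneGluing.AdditiveGluing :=
  additiveGluing_of_k0_k0set3
    (k0_of_phiTransfer (fun n w o b u v c => FibreCount.phiTransfer_of_fibres w o b u v c (stub_fibreSumPhi_nonneg_c15 n o b u v c))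
      stub_auxBeta_c14)
    stub_k0set3_g2

end

end Summit.CriticalPhenomena.PercolationContinuityZ3.Cruxes.AdditiveGluing.TieLine
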